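import Mathlib
import Summits.ValiantsHypothesis.ValiantsHypothesis.Theorems.FifoMatchingNNNotVPCliqueProgramBasics
import HarnessLib

/-!
# Route FifoMatching — crux `NNNotVP` (stmt-ValiantsHypothesis-11615), line `division_split`:
# the clique token program — ONE MACRO-ROUND of a run (the systolic shift is forced)

Companion of `…CliqueProgramDefs` / `…CliqueProgramBasics`.

* `run_macroRound` — in any run of `cliqueLab` (non-crossing position maps with all met labels
  switched on), if at a round `j₀ ≡ 0 (mod 5)` every token `i` is at home with registers
  `(a i, b i, ·)`, then at round `j₀ + 5` token `0` is at home with `(a 0, blank, blank)` and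
  token `i ≥ 1` at home with `(a i, b (i-1), b (i-1))`, the CHECK label `chk (a i) (b (i-1))`
  being switched on: the travelling register SHIFTS by one token per macro-round — forced by the
  two bucket filters (`key_eq_of_filter` applied to the even pairs at rounds A/B and to the odd
  pairs at rounds C/D) — and the shifted pair is checked at round E.

Honest framing: run semantics of the gadget; ACCEPT / REJECT and stub A are in the companions;
the crux `NNNotVP` and `VP ≠ VNP` stay OPEN (NOT proved).  No definitions, no named facts.
-/

noncomputable section

-- Sub = Summit single-conjunct layout: the duplicated namespace component is mandated by the tree.
set_option linter.dupNamespace false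

namespace Summit.ValiantsHypothesis.ValiantsHypothesis.Theorems.FifoMatching.NNNotVP.DivisionSplit

open Literature.Computability.Complexity
open scoped Classical

/-! ### One macro-round of a run (rounds A, B, C, D, E) -/

section Step

variable {k m : ℕ} (y : KEdge m → Bool)

/-- **One macro-round of a run.**  If at a round `j₀ ≡ 0 (mod 5)` every token `i` is at home
with registers `(a i, b i, ·)`, then five rounds later token `0` is at home with registers
`(a 0, blank, blank)` and every token `i ≥ 1` is at home with registers `(a i, b (i-1), b (i-1))`,
the CHECK label `chk (a i) (b (i-1))` being switched on: the travelling register has SHIFTED by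
one token (forced by the two bucket filters) and the shifted pair has been checked. [folklore] -/
theorem run_macroRound {R : ℕ} (P : Fin R → Fin k → Pos k m) (hP : ∀ j, StrictMono (P j))
    (hS : ∀ (j : Fin R) (h : j.val + 1 < R) (i : Fin k),
      Sum.elim y id (cliqueLab j (P j i) (P ⟨j.val + 1, h⟩ i)) = true)
    (a : Fin k → Fin m) (b : Fin k → Fin (m + 1)) (j₀ : Fin R) (hj₀ : j₀.val % 5 = 0)
    (hj5 : j₀.val + 5 < R) (hhome : ∀ i, ∃ c, P j₀ i = home i (mkRegs (a i) (b i) c)) :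
    (∀ i : Fin k, i.val = 0 →
      P ⟨j₀.val + 5, hj5⟩ i = home i (mkRegs (a i) (Fin.last m) (Fin.last m))) ∧
    ∀ (i : Fin k) (hi : 0 < i.val),
      P ⟨j₀.val + 5, hj5⟩ i =
        home i (mkRegs (a i) (b ⟨i.val - 1, by omega⟩) (b ⟨i.val - 1, by omega⟩)) ∧
      Sum.elim y id (chk (a i) (b ⟨i.val - 1, by omega⟩)) = true := by
  choose cc hcc using hhome
  -- the five labels met by token `i`
  have s1 : ∀ i, Sum.elim y id (labA (P j₀ i) (P ⟨j₀.val + 1, by omega⟩ i)) = true := by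
    intro i
    have := hS j₀ (by omega) i
    rwa [cliqueLab_eq, if_pos hj₀] at this
  have s2 : ∀ i, Sum.elim y id
      (labB (P ⟨j₀.val + 1, by omega⟩ i) (P ⟨j₀.val + 2, by omega⟩ i)) = true := by
    intro i
    have := hS ⟨j₀.val + 1, by omega⟩ (by dsimp only; omega) i
    rw [cliqueLab_eq] at this; dsimp only at this
    rwa [if_neg (by omega), if_pos (by omega)] at this
  have s3 : ∀ i, Sum.elim y id
      (labC (P ⟨j₀.val + 2, by omega⟩ i) (P ⟨j₀.val + 3, by omega⟩ i)) = true := by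
    intro i
    have := hS ⟨j₀.val + 2, by omega⟩ (by dsimp only; omega) i
    rw [cliqueLab_eq] at this; dsimp only at this
    rwa [if_neg (by omega), if_neg (by omega), if_pos (by omega)] at this
  have s4 : ∀ i, Sum.elim y id
      (labB (P ⟨j₀.val + 3, by omega⟩ i) (P ⟨j₀.val + 4, by omega⟩ i)) = true := by
    intro i
    have := hS ⟨j₀.val + 3, by omega⟩ (by dsimp only; omega) i
    rw [cliqueLab_eq] at this; dsimp only at this
    rwa [if_neg (by omega), if_neg (by omega), if_neg (by omega), if_pos (by omega)] at this
  have s5 : ∀ i, Sum.elim y id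
      (labE (P ⟨j₀.val + 4, by omega⟩ i) (P ⟨j₀.val + 5, hj5⟩ i)) = true := by
    intro i
    have := hS ⟨j₀.val + 4, by omega⟩ (by dsimp only; omega) i
    rw [cliqueLab_eq] at this; dsimp only at this
    rwa [if_neg (by omega), if_neg (by omega), if_neg (by omega), if_neg (by omega)] at this
  -- round A
  have hA0 : ∀ i : Fin k, i.val % 2 = 0 →
      P ⟨j₀.val + 1, by omega⟩ i = filt i (b i) 0 (mkRegs (a i) (b i) (cc i)) := by
    intro i hi
    have h := s1 i
    rw [hcc i, labA_on_iff_even y hi] at h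
    rw [h, bOf_mkRegs]
  have hA1 : ∀ i : Fin k, i.val % 2 = 1 → ∃ κ : Fin (m + 1),
      P ⟨j₀.val + 1, by omega⟩ i = filt ⟨i.val - 1, by omega⟩ κ 1 (mkRegs (a i) (b i) κ) := by
    intro i hi
    have h := s1 i
    rw [hcc i, labA_on_iff_odd y hi] at h
    simpa only [aOf_mkRegs, bOf_mkRegs] using h
  choose κ hκ using hA1
  -- round B
  have hB0 : ∀ i : Fin k, i.val % 2 = 0 →
      P ⟨j₀.val + 2, by omega⟩ i = filt i (revKey (b i)) 0 (mkRegs (a i) (b i) (cc i)) := by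
    intro i hi
    have h := s2 i
    rwa [hA0 i hi, labB_on_iff] at h
  have hB1 : ∀ (i : Fin k) (hi : i.val % 2 = 1), P ⟨j₀.val + 2, by omega⟩ i =
      filt ⟨i.val - 1, by omega⟩ (revKey (κ i hi)) 1 (mkRegs (a i) (b i) (κ i hi)) := by
    intro i hi
    have h := s2 i
    rwa [hκ i hi, labB_on_iff] at h
  -- the even filter: `κ (i+1) = b i` for even `i` with `i + 1 < k`
  have hfilt0 : ∀ (i : Fin k) (hi : i.val % 2 = 0) (hi1 : i.val + 1 < k),
      κ ⟨i.val + 1, hi1⟩ (by dsimp only; omega) = b i := by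
    intro i hi hi1
    have hodd : (⟨i.val + 1, hi1⟩ : Fin k).val % 2 = 1 := by dsimp only; omega
    have e : (⟨(⟨i.val + 1, hi1⟩ : Fin k).val - 1, by dsimp only; omega⟩ : Fin k) = i :=
      Fin.ext (by simp)
    have lt : i < ⟨i.val + 1, hi1⟩ := Fin.lt_def.2 (by simp)
    have h1 := hP ⟨j₀.val + 1, by omega⟩ lt
    have h2 := hP ⟨j₀.val + 2, by omega⟩ lt
    rw [hA0 i hi, hκ _ hodd, e] at h1
    rw [hB0 i hi, hB1 _ hodd, e] at h2
    exact key_eq_of_filter h1 h2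
  -- round C
  have hC00 : ∀ i : Fin k, i.val = 0 →
      P ⟨j₀.val + 3, by omega⟩ i = home i (mkRegs (a i) (b i) (Fin.last m)) := by
    intro i hi
    have h := s3 i
    rw [hB0 i (by omega), labC_on_iff_zero y hi] at h
    simpa only [aOf_mkRegs, bOf_mkRegs] using h
  have hC0 : ∀ i : Fin k, i.val % 2 = 0 → i.val ≠ 0 → ∃ κ' : Fin (m + 1),
      P ⟨j₀.val + 3, by omega⟩ i = filt ⟨i.val - 1, by omega⟩ κ' 1 (mkRegs (a i) (b i) κ') := by
    intro i hi hi0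
    have h := s3 i
    rw [hB0 i hi, labC_on_iff_pos y hi0] at h
    simpa only [aOf_mkRegs, bOf_mkRegs] using h
  choose κ' hκ' using hC0
  have hC1 : ∀ (i : Fin k) (hi : i.val % 2 = 1),
      P ⟨j₀.val + 3, by omega⟩ i = filt i (b i) 0 (mkRegs (a i) (b i) (κ i hi)) := by
    intro i hi
    have h := s3 i
    have hb : (⟨i.val - 1, by omega⟩ : Fin k).val + 1 < k := by dsimp only; omega
    rw [hB1 i hi, labC_on_iff_one y hb] at h
    rw [h, bOf_mkRegs]
    congr 1
    exact Fin.ext (by simp; omega)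
  -- round D
  have hD00 : ∀ i : Fin k, i.val = 0 →
      P ⟨j₀.val + 4, by omega⟩ i = filt i (revKey 0) 0 (mkRegs (a i) (b i) (Fin.last m)) := by
    intro i hi
    have h := s4 i
    rwa [hC00 i hi, home_eq, labB_on_iff] at h
  have hD0 : ∀ (i : Fin k) (hi : i.val % 2 = 0) (hi0 : i.val ≠ 0), P ⟨j₀.val + 4, by omega⟩ i =
      filt ⟨i.val - 1, by omega⟩ (revKey (κ' i hi hi0)) 1 (mkRegs (a i) (b i) (κ' i hi hi0)) := by
    intro i hi hi0
    have h := s4 i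
    rwa [hκ' i hi hi0, labB_on_iff] at h
  have hD1 : ∀ (i : Fin k) (hi : i.val % 2 = 1), P ⟨j₀.val + 4, by omega⟩ i =
      filt i (revKey (b i)) 0 (mkRegs (a i) (b i) (κ i hi)) := by
    intro i hi
    have h := s4 i
    rwa [hC1 i hi, labB_on_iff] at h
  -- the odd filter: `κ' (i+1) = b i` for odd `i` with `i + 1 < k`
  have hfilt1 : ∀ (i : Fin k) (hi : i.val % 2 = 1) (hi1 : i.val + 1 < k),
      κ' ⟨i.val + 1, hi1⟩ (by dsimp only; omega) (by dsimp only; omega) = b i := by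
    intro i hi hi1
    have hev : (⟨i.val + 1, hi1⟩ : Fin k).val % 2 = 0 := by dsimp only; omega
    have hne : (⟨i.val + 1, hi1⟩ : Fin k).val ≠ 0 := by dsimp only; omega
    have e : (⟨(⟨i.val + 1, hi1⟩ : Fin k).val - 1, by dsimp only; omega⟩ : Fin k) = i :=
      Fin.ext (by simp)
    have lt : i < ⟨i.val + 1, hi1⟩ := Fin.lt_def.2 (by simp)
    have h1 := hP ⟨j₀.val + 3, by omega⟩ lt
    have h2 := hP ⟨j₀.val + 4, by omega⟩ lt
    rw [hC1 i hi, hκ' _ hev hne, e] at h1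
    rw [hD1 i hi, hD0 _ hev hne, e] at h2
    exact key_eq_of_filter h1 h2
  -- round E
  refine ⟨fun i hi => ?_, fun i hi => ?_⟩
  · have h := s5 i
    have hbs : i.val + (0 : Fin 2).val < k := by simp
    rw [hD00 i hi, labE_on_iff y hbs] at h
    obtain ⟨h, -⟩ := h
    rw [h]
    simp only [aOf_mkRegs, cOf_mkRegs]
    rfl
  · rcases Nat.mod_two_eq_zero_or_one i.val with hpar | hpar
    · -- even `i ≥ 2`: staged `κ' i = b (i-1)` by the odd filter at `i - 1`
      have hi0 : i.val ≠ 0 := by omega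
      have h := s5 i
      have hbs : (⟨i.val - 1, by omega⟩ : Fin k).val + (1 : Fin 2).val < k := by
        dsimp only; simp; omega
      rw [hD0 i hpar hi0, labE_on_iff y hbs] at h
      simp only [aOf_mkRegs, cOf_mkRegs] at h
      have ei : (⟨(⟨i.val - 1, by omega⟩ : Fin k).val + (1 : Fin 2).val, hbs⟩ : Fin k) = i :=
        Fin.ext (by simp; omega)
      rw [ei] at h
      have hprev : (⟨i.val - 1, by omega⟩ : Fin k).val % 2 = 1 := by dsimp only; omega
      have hk' := hfilt1 ⟨i.val - 1, by omega⟩ hprev (by dsimp only; omega)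
      have ei' : (⟨(⟨i.val - 1, by omega⟩ : Fin k).val + 1, by dsimp only; omega⟩ : Fin k) = i :=
        Fin.ext (by simp; omega)
      -- transport `κ'` along `ei'`
      have hk'' : κ' i hpar hi0 = b ⟨i.val - 1, by omega⟩ := by
        have := hk'
        revert this
        generalize_proofs p1 p2 p3
        intro this
        have key : ∀ (i' : Fin k) (e : i' = i) (q1 : i'.val % 2 = 0) (q2 : i'.val ≠ 0),
            κ' i' q1 q2 = b ⟨i.val - 1, by omega⟩ → κ' i hpar hi0 = b ⟨i.val - 1, by omega⟩ := by
          intro i' e q1 q2 h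
          subst e
          exact h
        exact key _ ei' _ _ this
      rw [hk''] at h
      exact h
    · -- odd `i`: staged `κ i = b (i-1)` by the even filter at `i - 1`
      have h := s5 i
      have hbs : i.val + (0 : Fin 2).val < k := by simp
      rw [hD1 i hpar, labE_on_iff y hbs] at h
      simp only [aOf_mkRegs, cOf_mkRegs] at h
      have ei : (⟨i.val + (0 : Fin 2).val, hbs⟩ : Fin k) = i := Fin.ext (by simp)
      rw [ei] at h
      have hprev : (⟨i.val - 1, by omega⟩ : Fin k).val % 2 = 0 := by dsimp only; omega
      have hk0 := hfilt0 ⟨i.val - 1, by omega⟩ hprev (by dsimp only; omega)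
      have ei' : (⟨(⟨i.val - 1, by omega⟩ : Fin k).val + 1, by dsimp only; omega⟩ : Fin k) = i :=
        Fin.ext (by simp; omega)
      have hk'' : κ i hpar = b ⟨i.val - 1, by omega⟩ := by
        have := hk0
        revert this
        generalize_proofs p1 p2
        intro this
        have key : ∀ (i' : Fin k) (e : i' = i) (q1 : i'.val % 2 = 1),
            κ i' q1 = b ⟨i.val - 1, by omega⟩ → κ i hpar = b ⟨i.val - 1, by omega⟩ := by
          intro i' e q1 h
          subst e
          exact h
        exact key _ ei' _ this
      rw [hk''] at h
      exact h

end Step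

end Summit.ValiantsHypothesis.ValiantsHypothesis.Theorems.FifoMatching.NNNotVP.DivisionSplit

end
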